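import Summits.Schanuel.Schanuel.Theorems.ZilberEacParamCurveEscapePoly
import Summits.Schanuel.Schanuel.Theorems.ZilberEacGraphSurfaceEdge
import HarnessLib

/-!
# Polynomially parametrised base curves, X: NON-SPLIT surfaces `{(g(t), y) : Q(t; y₀, y₁) = 0}` —
# the edge decomposition with polynomial coefficients and the escaping exponential points
# (balanced edge)

HONEST FRAMING.  Cell `pub-schanuel` (Zilber's Exponential-Algebraic Closedness, case ladder;
host summit Schanuel), seat 2, gen 19.  Over a polynomial curve `C = g(ℂ)` a surface of
Mantova–Masser's case need not be a product: `W = {(g₀(t), g₁(t), y₀, y₁) : Q(t; y₀, y₁) = 0}`,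
`Q ∈ ℂ[t, y₀, y₁]` irreducible, the fibre curve moving with the parameter.  Along `C`,
`Q(t; e^{g₀(t)}, e^{g₁(t)}) = Σ_m c_m t^{m₀} e^{m₁ g₀(t) + m₂ g₁(t)}`; gen 16's edge identity
(`eval₃_exp_eq_mul_edgeSum`, for `(z, e^z, e^{p(z)})`) is re-proved here for three free numbers
`(t, x₀, x₁)` (Part A), and the directional engine with polynomial coefficients (file IX) yields
zeros `t_k` with `|Re g₀(t_k)| / log(2 + ‖g₀(t_k)‖) → ∞` when the lower-left edge of the
`y`-support is BALANCED (its top `t`-degree is attained by monomials whose edge polynomial has a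
nonzero root) and the root direction has `Re(lc(g₀) ω^{deg g₀}) < 0` (Part B).  Density:
`ZilberEacParamSurfaceDensity`.  Instances of an OPEN question (PLMS 2024, §1 p. 5); NOT Schanuel's
conjecture (neither used nor implied; EAC ⇏ SC); `EC(3,2)` stays OPEN.  UNBALANCED edges over
polynomial curves (logarithmic balance, gen 17's engine v3) are left open here.

Variables of `Q : MvPolynomial (Fin 3) ℂ`: `0 ↦ t`, `1 ↦ y₀`, `2 ↦ y₁`; weight
`w(m) = m₁ − s m₂`.
-/

noncomputable section

open Filter Topology Metric Set Complex
open Literature.ModelTheory.Zilber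

set_option linter.dupNamespace false

namespace Summit.Schanuel.Schanuel.Theorems

/-! ## Part A. The edge decomposition in three free numbers -/

section EdgeSum

variable (P : MvPolynomial (Fin 3) ℂ)

/-- `Q(t; e^{x₀}, e^{x₁}) = Σ_{m ∈ supp Q} c_m t^{m₀} e^{m₁ x₀ + m₂ x₁}`. -/
theorem eval₃_exp_exp_eq_sum (t x₀ x₁ : ℂ) :
    MvPolynomial.eval ![t, exp x₀, exp x₁] P =
      ∑ m ∈ P.support, P.coeff m * t ^ (m 0) * exp ((m 1 : ℂ) * x₀ + (m 2 : ℂ) * x₁) := by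
  rw [MvPolynomial.eval_eq']
  refine Finset.sum_congr rfl fun m _ => ?_
  simp only [Fin.prod_univ_three, Matrix.cons_val_zero, Matrix.cons_val_one,
    Matrix.cons_val_two, Matrix.tail_cons, Matrix.head_cons, Complex.exp_add, Complex.exp_nat_mul]
  ring

variable {P} {s : ℝ} {mb : Fin 3 →₀ ℕ}

/-- **Edge decomposition (polynomial coefficients, free exponents).**  With
`M = {m ∈ supp Q : w(m) = w(m_b)}` and `(m_b)₂ ≤ m₂` on `M`:
`Q(t; e^{x₀}, e^{x₁}) = e^{(m_b)₁ x₀ + (m_b)₂ x₁} · (Σ_{m ∈ M} (c_m X^{m₀})(t) · (e^{x₁ + s x₀})^{m₂ - (m_b)₂} + E)`,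
`E = Σ_{m ∉ M} c_m t^{m₀} e^{(w(m)-w(m_b)) x₀ + (m₂ - (m_b)₂)(x₁ + s x₀)}`. (new) -/
theorem eval₃_exp_exp_eq_mul_edgeSum
    (hE2 : ∀ m ∈ P.support, ((m 1 : ℝ) - s * m 2) = (mb 1 : ℝ) - s * mb 2 → mb 2 ≤ m 2)
    (t x₀ x₁ : ℂ) :
    MvPolynomial.eval ![t, exp x₀, exp x₁] P =
      exp ((mb 1 : ℂ) * x₀ + (mb 2 : ℂ) * x₁) *
        ((∑ m ∈ P.support.filter (fun m : Fin 3 →₀ ℕ => ((m 1 : ℝ) - s * m 2) = (mb 1 : ℝ) - s * mb 2),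
            (Polynomial.C (P.coeff m) * Polynomial.X ^ (m 0)).eval t *
              exp (x₁ + (s : ℂ) * x₀) ^ (m 2 - mb 2)) +
          ∑ m ∈ P.support.filter
              (fun m : Fin 3 →₀ ℕ => ¬ ((m 1 : ℝ) - s * m 2) = (mb 1 : ℝ) - s * mb 2),
            P.coeff m * t ^ (m 0) *
              exp ((((m 1 : ℝ) - s * m 2 - ((mb 1 : ℝ) - s * mb 2) : ℝ) : ℂ) * x₀ +
                (((m 2 : ℝ) - mb 2 : ℝ) : ℂ) * (x₁ + (s : ℂ) * x₀))) := by
  classical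
  rw [eval₃_exp_exp_eq_sum, mul_add, Finset.mul_sum, Finset.mul_sum,
    ← Finset.sum_filter_add_sum_filter_not P.support
      (fun m : Fin 3 →₀ ℕ => ((m 1 : ℝ) - s * m 2) = (mb 1 : ℝ) - s * mb 2)]
  congr 1
  · refine Finset.sum_congr rfl fun m hm => ?_
    obtain ⟨hmA, hmw⟩ := Finset.mem_filter.1 hm
    have hle : mb 2 ≤ m 2 := hE2 m hmA hmw
    have hwC := congrArg (fun r : ℝ => (r : ℂ)) hmw
    push_cast at hwC
    rw [Polynomial.eval_mul, Polynomial.eval_C, Polynomial.eval_pow, Polynomial.eval_X,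
      ← Complex.exp_nat_mul, Nat.cast_sub hle]
    rw [show exp ((mb 1 : ℂ) * x₀ + (mb 2 : ℂ) * x₁) *
        (P.coeff m * t ^ (m 0) * exp (((m 2 : ℂ) - (mb 2 : ℂ)) * (x₁ + (s : ℂ) * x₀))) =
        P.coeff m * t ^ (m 0) * (exp ((mb 1 : ℂ) * x₀ + (mb 2 : ℂ) * x₁) *
          exp (((m 2 : ℂ) - (mb 2 : ℂ)) * (x₁ + (s : ℂ) * x₀))) by ring, ← Complex.exp_add]
    congr 2
    linear_combination x₀ * hwC
  · refine Finset.sum_congr rfl fun m _ => ?_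
    rw [show exp ((mb 1 : ℂ) * x₀ + (mb 2 : ℂ) * x₁) * (P.coeff m * t ^ (m 0) *
        exp ((((m 1 : ℝ) - s * m 2 - ((mb 1 : ℝ) - s * mb 2) : ℝ) : ℂ) * x₀ +
          (((m 2 : ℝ) - mb 2 : ℝ) : ℂ) * (x₁ + (s : ℂ) * x₀))) =
        P.coeff m * t ^ (m 0) * (exp ((mb 1 : ℂ) * x₀ + (mb 2 : ℂ) * x₁) *
          exp ((((m 1 : ℝ) - s * m 2 - ((mb 1 : ℝ) - s * mb 2) : ℝ) : ℂ) * x₀ +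
            (((m 2 : ℝ) - mb 2 : ℝ) : ℂ) * (x₁ + (s : ℂ) * x₀))) by ring, ← Complex.exp_add]
    congr 2
    push_cast
    ring

/-- **The off-edge part is small in the regime** `Re x₀ ≤ 0`, `|Re(x₁ + s x₀)| ≤ B`, up to the
polynomial weight `(1 + ‖t‖)^N` (`N` bounds the `t`-degrees). (new) -/
theorem norm_offEdgeSum₃_le₂ {δ B : ℝ} {N : ℕ}
    (hδ : ∀ m ∈ P.support, ¬ ((m 1 : ℝ) - s * m 2) = (mb 1 : ℝ) - s * mb 2 →
      δ ≤ ((m 1 : ℝ) - s * m 2) - ((mb 1 : ℝ) - s * mb 2))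
    (hN : ∀ m ∈ P.support, m 0 ≤ N)
    {t x₀ x₁ : ℂ} (hx : x₀.re ≤ 0) (hB : |(x₁ + (s : ℂ) * x₀).re| ≤ B) :
    ‖∑ m ∈ P.support.filter
          (fun m : Fin 3 →₀ ℕ => ¬ ((m 1 : ℝ) - s * m 2) = (mb 1 : ℝ) - s * mb 2),
        P.coeff m * t ^ (m 0) *
          exp ((((m 1 : ℝ) - s * m 2 - ((mb 1 : ℝ) - s * mb 2) : ℝ) : ℂ) * x₀ +
            (((m 2 : ℝ) - mb 2 : ℝ) : ℂ) * (x₁ + (s : ℂ) * x₀))‖ ≤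
      (∑ m ∈ P.support.filter
          (fun m : Fin 3 →₀ ℕ => ¬ ((m 1 : ℝ) - s * m 2) = (mb 1 : ℝ) - s * mb 2),
          ‖P.coeff m‖ * Real.exp (|(m 2 : ℝ) - mb 2| * B)) * (1 + ‖t‖) ^ N * Real.exp (δ * x₀.re) := by
  classical
  rw [Finset.sum_mul, Finset.sum_mul]
  refine (norm_sum_le _ _).trans (Finset.sum_le_sum fun m hm => ?_)
  obtain ⟨hmA, hmw⟩ := Finset.mem_filter.1 hm
  rw [norm_mul, norm_mul, norm_pow, Complex.norm_exp, Complex.add_re, Complex.re_ofReal_mul,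
    Complex.re_ofReal_mul]
  have h1 : ((m 1 : ℝ) - s * m 2 - ((mb 1 : ℝ) - s * mb 2)) * x₀.re ≤ δ * x₀.re :=
    mul_le_mul_of_nonpos_right (hδ m hmA hmw) hx
  have h2 : ((m 2 : ℝ) - mb 2) * (x₁ + (s : ℂ) * x₀).re ≤ |(m 2 : ℝ) - mb 2| * B := by
    refine (le_abs_self _).trans ?_
    rw [abs_mul]
    exact mul_le_mul_of_nonneg_left hB (abs_nonneg _)
  have htN : ‖t‖ ^ (m 0) ≤ (1 + ‖t‖) ^ N :=
    (pow_le_pow_left₀ (norm_nonneg _) (by linarith [norm_nonneg t]) _).trans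
      (pow_le_pow_right₀ (by linarith [norm_nonneg t]) (hN m hmA))
  have hexp : Real.exp (((m 1 : ℝ) - s * m 2 - ((mb 1 : ℝ) - s * mb 2)) * x₀.re +
      ((m 2 : ℝ) - mb 2) * (x₁ + (s : ℂ) * x₀).re) ≤
      Real.exp (|(m 2 : ℝ) - mb 2| * B) * Real.exp (δ * x₀.re) := by
    rw [← Real.exp_add]; exact Real.exp_le_exp.2 (by linarith)
  calc ‖P.coeff m‖ * ‖t‖ ^ (m 0) * Real.exp (((m 1 : ℝ) - s * m 2 - ((mb 1 : ℝ) - s * mb 2)) * x₀.re +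
        ((m 2 : ℝ) - mb 2) * (x₁ + (s : ℂ) * x₀).re)
      ≤ ‖P.coeff m‖ * (1 + ‖t‖) ^ N * (Real.exp (|(m 2 : ℝ) - mb 2| * B) * Real.exp (δ * x₀.re)) :=
        mul_le_mul (mul_le_mul_of_nonneg_left htN (norm_nonneg _)) hexp (Real.exp_nonneg _)
          (by positivity)
    _ = ‖P.coeff m‖ * Real.exp (|(m 2 : ℝ) - mb 2| * B) * (1 + ‖t‖) ^ N * Real.exp (δ * x₀.re) := by
        ring

end EdgeSum

/-! ## Part B. Escaping exponential points (balanced edge) -/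

/-- **Escaping zeros of `Q(t; e^{g₀(t)}, e^{g₁(t)})` for a balanced edge.**  Let `deg g₀ ≥ 1`; let
`(s, m_b)` be lower-left edge data of the `y`-support of `Q` (weight `w(m) = m₁ - s m₂` minimal at
`m_b`, `(m_b)₂ ≤ m₂` on the minimisers `M`), `n` a bound for the `t`-degrees on `M` such that the top
polynomial `Σ_{m ∈ M, m₀ = n} c_m X^{m₂ - (m_b)₂}` is nonzero with a root `θ ≠ 0`; and let
`R = g₁ + s g₀` have degree `≥ 2` and a root direction `ω` with `Re(lc(g₀) ω^{deg g₀}) < 0`.  Then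
there are `t_k` with `Q(t_k; e^{g₀(t_k)}, e^{g₁(t_k)}) = 0` and
`|Re g₀(t_k)|/log(2 + ‖g₀(t_k)‖) → ∞`. (new) -/
theorem exists_paramSurface_expPoints_of_edge (g₀ g₁ : Polynomial ℂ) (hg₀ : 1 ≤ g₀.natDegree)
    (P : MvPolynomial (Fin 3) ℂ) {s : ℝ} {mb : Fin 3 →₀ ℕ}
    (hE1 : ∀ m ∈ P.support, ((mb 1 : ℝ) - s * mb 2) ≤ (m 1 : ℝ) - s * m 2)
    (hE2 : ∀ m ∈ P.support, ((m 1 : ℝ) - s * m 2) = (mb 1 : ℝ) - s * mb 2 → mb 2 ≤ m 2)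
    (n : ℕ)
    (hn : ∀ m ∈ P.support, ((m 1 : ℝ) - s * m 2) = (mb 1 : ℝ) - s * mb 2 → m 0 ≤ n)
    {θ : ℂ} (hθ0 : θ ≠ 0)
    (hθ : (∑ m ∈ P.support.filter
        (fun m : Fin 3 →₀ ℕ => ((m 1 : ℝ) - s * m 2) = (mb 1 : ℝ) - s * mb 2),
        Polynomial.C ((Polynomial.C (P.coeff m) * Polynomial.X ^ (m 0)).coeff n) *
          Polynomial.X ^ (m 2 - mb 2)).eval θ = 0)
    (hQ : (∑ m ∈ P.support.filter
        (fun m : Fin 3 →₀ ℕ => ((m 1 : ℝ) - s * m 2) = (mb 1 : ℝ) - s * mb 2),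
        Polynomial.C ((Polynomial.C (P.coeff m) * Polynomial.X ^ (m 0)).coeff n) *
          Polynomial.X ^ (m 2 - mb 2)) ≠ 0)
    (hdR : 2 ≤ (g₁ + Polynomial.C (s : ℂ) * g₀).natDegree) {ω : ℂ} {σ : ℤ} (hσ : σ = 1 ∨ σ = -1)
    (hω : (g₁ + Polynomial.C (s : ℂ) * g₀).leadingCoeff *
        ω ^ (g₁ + Polynomial.C (s : ℂ) * g₀).natDegree = 2 * Real.pi * I * σ)
    (hre : (g₀.leadingCoeff * ω ^ g₀.natDegree).re < 0) :
    ∃ t : ℕ → ℂ, (∀ k, MvPolynomial.eval ![t k, exp (g₀.eval (t k)), exp (g₁.eval (t k))] P = 0) ∧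
      Tendsto (fun k => |(g₀.eval (t k)).re| / Real.log (2 + ‖g₀.eval (t k)‖)) atTop atTop := by
  classical
  set R : Polynomial ℂ := g₁ + Polynomial.C (s : ℂ) * g₀ with hR
  have hReval : ∀ t : ℂ, R.eval t = g₁.eval t + (s : ℂ) * g₀.eval t := by
    intro t; simp [hR, Polynomial.eval_add, Polynomial.eval_mul]
  set M := P.support.filter
    (fun m : Fin 3 →₀ ℕ => ((m 1 : ℝ) - s * m 2) = (mb 1 : ℝ) - s * mb 2) with hM
  set Nf := P.support.filter
    (fun m : Fin 3 →₀ ℕ => ¬ ((m 1 : ℝ) - s * m 2) = (mb 1 : ℝ) - s * mb 2) with hNf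
  -- the weight gap `δ` and the `t`-degree bound `N`
  obtain ⟨δ, hδpos, hδ⟩ : ∃ δ : ℝ, 0 < δ ∧ ∀ m ∈ P.support,
      ¬ ((m 1 : ℝ) - s * m 2) = (mb 1 : ℝ) - s * mb 2 →
        δ ≤ ((m 1 : ℝ) - s * m 2) - ((mb 1 : ℝ) - s * mb 2) := by
    by_cases hNe : Nf.Nonempty
    · obtain ⟨mm, hmm, hmmmin⟩ := Nf.exists_min_image
        (fun m => ((m 1 : ℝ) - s * m 2) - ((mb 1 : ℝ) - s * mb 2)) hNe
      obtain ⟨hmmA, hmmw⟩ := Finset.mem_filter.1 hmm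
      refine ⟨((mm 1 : ℝ) - s * mm 2) - ((mb 1 : ℝ) - s * mb 2), ?_, fun m hm hmw =>
        hmmmin m (Finset.mem_filter.2 ⟨hm, hmw⟩)⟩
      have := hE1 mm hmmA
      rcases this.lt_or_eq with h | h
      · linarith
      · exact absurd h.symm hmmw
    · refine ⟨1, zero_lt_one, fun m hm hmw => ?_⟩
      exact absurd ⟨m, Finset.mem_filter.2 ⟨hm, hmw⟩⟩ hNe
  set N : ℕ := P.support.sup (fun m => m 0) with hNdef
  have hN : ∀ m ∈ P.support, m 0 ≤ N := fun m hm => Finset.le_sup (f := fun m => m 0) hm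
  -- the off-edge part
  set E : ℂ → ℂ := fun t => ∑ m ∈ Nf, P.coeff m * t ^ (m 0) *
    exp ((((m 1 : ℝ) - s * m 2 - ((mb 1 : ℝ) - s * mb 2) : ℝ) : ℂ) * g₀.eval t +
      (((m 2 : ℝ) - mb 2 : ℝ) : ℂ) * R.eval t) with hEdef
  have hEdiff : Differentiable ℂ E := by
    refine Differentiable.fun_sum fun m _ => ?_
    refine ((differentiable_const _).mul (differentiable_id.pow _)).mul ?_
    refine (((differentiable_const _).mul (Polynomial.differentiable _)).add
      ((differentiable_const _).mul (Polynomial.differentiable _))).cexp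
  have hEb : ∀ B : ℝ, ∃ C : ℝ, 0 ≤ C ∧ ∃ N' : ℕ,
      ∀ t : ℂ, (g₀.eval t).re ≤ 0 → |(R.eval t).re| ≤ B →
        ‖E t‖ ≤ C * (1 + ‖t‖) ^ N' * Real.exp (δ * (g₀.eval t).re) := by
    intro B
    refine ⟨∑ m ∈ Nf, ‖P.coeff m‖ * Real.exp (|(m 2 : ℝ) - mb 2| * B),
      Finset.sum_nonneg fun m _ => by positivity, N, fun t ht htB => ?_⟩
    have htB' : |(g₁.eval t + (s : ℂ) * g₀.eval t).re| ≤ B := by rwa [hReval] at htB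
    have h := norm_offEdgeSum₃_le₂ (P := P) hδ hN (t := t) ht htB'
    simp only [hEdef, hReval]
    exact h
  -- the engine with polynomial coefficients
  obtain ⟨t, L, A, hL, ht⟩ := exists_escape_zeros_poly_dir R g₀ hdR hg₀ M
    (fun m => Polynomial.C (P.coeff m) * Polynomial.X ^ (m 0)) (fun m => m 2 - mb 2) n
    (fun m hm => by
      obtain ⟨hmA, hmw⟩ := Finset.mem_filter.1 hm
      exact (Polynomial.natDegree_C_mul_le _ _).trans
        ((Polynomial.natDegree_pow_le).trans (by simpa using hn m hmA hmw)))
    hθ0 hθ hQ ω σ hσ hω hre E hEdiff hδpos hEb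
  refine ⟨t, fun k => ?_, tendsto_abs_re_div_log_of_escape hL (fun k => (ht k).2.1)
    (fun k => (ht k).2.2)⟩
  rw [eval₃_exp_exp_eq_mul_edgeSum hE2 (t k) (g₀.eval (t k)) (g₁.eval (t k))]
  have h := (ht k).1
  rw [hEdef] at h
  simp only [hReval] at h
  rw [h, mul_zero]

end Summit.Schanuel.Schanuel.Theorems
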